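import Mathlib
import HarnessLib.Audit
import Summits.PneNP.PneNP.Theorems.PstarMaxSharingCentre

/-!
# Slack accounting tools: degree-two endpoints of clean chords, pair deletion, inside gates (ROUND-24, O1; memo g25 §45)

FRONTIER range-avoidance ladder, rung F-N3, ROUND 24 (cell `pnp-ideate`, prover-2 memo `g25/O1-XORSPLIT-g25.md` §45; typed targets
`PstarCoreBoundTargets.TerminalFive` / `TerminalPeelable` (p646951); restricted-model proof complexity — nothing here bears on `P` versus `NP`).

Counting tools behind `PstarMaxSharingCentre.no_centre_at_max_sharing` (slack `t = 2·#bdry K − 3·#K = 0`), isolated and extended for the next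
layer `t = 1` (`PstarSlackOneCentre`):
* `three_le_card_xverts_of_leafless` — a non-empty leafless family has at least three XOR vertices (simple overlaps);
* `card_deg2_chords_add_le` — in a COVERED family, clean chords having an XOR endpoint of degree two inject into the vertices off any leafless
  set of non-chords: `#C₂ + #xverts S ≤ #xverts K`;
* `degIn_insert`, `card_bdry_insert_le` — adding one output whose AND variables are already read by the family and which touches a boundary
  variable raises `#bdry` by at most one (the accounting of an INSIDE gate);
* `exists_shared_deg_three` — with `2·#bdry K ≤ 3·#K + 1`, two clean chords none of whose endpoints has degree two share an endpoint of degree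
  exactly three (expansion of `K` minus both, via `PstarMaxSharingCentre.card_bdry_erase_le` twice).
-/

set_option linter.dupNamespace false -- `Summit.PneNP.PneNP.…`: summit = sub-problem name (D-0017 single-conjunct layout)

open Finset Literature.Computability.Complexity
open Summit.PneNP.PneNP.Theorems.PstarTyped (Typed)
open Summit.PneNP.PneNP.Theorems.PstarSALevel (varSet bdry BoundaryExpanding SimpleOverlap)
open Summit.PneNP.PneNP.Theorems.PstarSAClosure (degIn mem_bdry_iff)
open Summit.PneNP.PneNP.Theorems.PstarXCore (xpair mem_xpair xverts)
open Summit.PneNP.PneNP.Theorems.PstarCentreFree (vars_mem_varSet)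
open Summit.PneNP.PneNP.Theorems.PstarCoreBound (XorClosed)
open Summit.PneNP.PneNP.Theorems.PstarChordRepair (IsChord)
open Summit.PneNP.PneNP.Theorems.PstarChordBridgeTools (xpdeg)
open Summit.PneNP.PneNP.Theorems.PstarChordBridgeExchange (mem_xverts_iff)
open Summit.PneNP.PneNP.Theorems.PstarNorUnitCoverTools (exists_ne_of_two_le_xpdeg)
open Summit.PneNP.PneNP.Theorems.PstarChordReadOutside (OutsideGated)
open Summit.PneNP.PneNP.Theorems.PstarNoFreeVertex (Covered mem_varSet_of_mem_xpair mem_xpair_of_mem_varSet)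
open Summit.PneNP.PneNP.Theorems.PstarSkeletonSpan (xverts_mono)
open Summit.PneNP.PneNP.Theorems.PstarMaxSharingCentre (degIn_erase card_bdry_erase_le)

namespace Summit.PneNP.PneNP.Theorems.PstarSlackTools

variable {n m : ℕ}

/-! ## A leafless family has three vertices -/

/-- **A non-empty leafless family has at least three XOR vertices** (simple overlaps: two members never share both XOR variables). -/
theorem three_le_card_xverts_of_leafless (I : LocalMap 4 n m) (hI : I.IsPure xorAndPred) (hS : SimpleOverlap I) {S : Finset (Fin m)}
    (hne : S.Nonempty) (hL : ∀ w ∈ xverts I S, 2 ≤ xpdeg I S w) : 3 ≤ (xverts I S).card := by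
  classical
  obtain ⟨s, hs⟩ := hne
  have h01 : ∀ j : Fin m, I.vars j 0 ≠ I.vars j 1 := fun j h => absurd (hI.2 j h) (by decide)
  set a := I.vars s 0 with ha
  set b := I.vars s 1 with hb
  have haS : a ∈ xverts I S := (mem_xverts_iff I S a).2 ⟨s, hs, (mem_xpair I).2 (Or.inl rfl)⟩
  have hbS : b ∈ xverts I S := (mem_xverts_iff I S b).2 ⟨s, hs, (mem_xpair I).2 (Or.inr rfl)⟩
  obtain ⟨s', hs', hs's, has'⟩ := exists_ne_of_two_le_xpdeg I hI s (hL a haS)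
  -- the other endpoint `c` of `s'`
  obtain ⟨c, hcs', hca⟩ : ∃ c, c ∈ xpair I s' ∧ c ≠ a := by
    rcases (mem_xpair I).1 has' with h | h
    · exact ⟨I.vars s' 1, (mem_xpair I).2 (Or.inr rfl), fun e => h01 s' (h ▸ e.symm)⟩
    · exact ⟨I.vars s' 0, (mem_xpair I).2 (Or.inl rfl), fun e => h01 s' (e.trans h)⟩
  have hcS : c ∈ xverts I S := (mem_xverts_iff I S c).2 ⟨s', hs', hcs'⟩
  -- `c ≠ b`: otherwise `s, s'` share the two variables `a, b`
  have hcb : c ≠ b := by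
    intro hcb
    have h2 : ({a, b} : Finset (Fin n)) ⊆ varSet I s ∩ varSet I s' := by
      intro v hv
      rw [mem_inter]
      rcases mem_insert.1 hv with rfl | hv
      · exact ⟨vars_mem_varSet I s 0, mem_varSet_of_mem_xpair has'⟩
      · rw [mem_singleton.1 hv]; exact ⟨vars_mem_varSet I s 1, mem_varSet_of_mem_xpair (hcb ▸ hcs')⟩
    have hcard := (card_le_card h2).trans (hS s s' (Ne.symm hs's))
    rw [card_pair (h01 s)] at hcard
    omega
  have h3 : ({a, b, c} : Finset (Fin n)) ⊆ xverts I S := by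
    intro v hv
    rcases mem_insert.1 hv with rfl | hv
    · exact haS
    rcases mem_insert.1 hv with rfl | hv
    · exact hbS
    · rw [mem_singleton.1 hv]; exact hcS
  have hcard : ({a, b, c} : Finset (Fin n)).card = 3 := by
    rw [card_insert_of_notMem, card_pair hcb.symm]
    rw [mem_insert, mem_singleton]; push Not; exact ⟨h01 s, hca.symm⟩
  exact hcard ▸ card_le_card h3

/-! ## Clean chords with a degree-two endpoint inject into the non-centre vertices -/

/-- **Degree-two endpoints.**  In a covered family, a set `C₂` of outside-gated chords each having an XOR endpoint read by exactly two members
injects into the XOR vertices off any leafless set `S` of non-chords: `#C₂ + #xverts S ≤ #xverts K`.  (At such an endpoint the second member is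
the covering non-clean member, so it determines the chord; a vertex of `S` carries two members of `S`.) -/
theorem card_deg2_chords_add_le (I : LocalMap 4 n m) (hI : I.IsPure xorAndPred) {K M : Finset (Fin m)} (hcov : Covered I K M)
    {C₂ : Finset (Fin m)} (hC : ∀ c ∈ C₂, c ∈ K ∧ IsChord I K c ∧ OutsideGated I K M c ∧ ∃ w ∈ xpair I c, degIn I K w = 2)
    {S : Finset (Fin m)} (hSK : S ⊆ K) (hSL : ∀ w ∈ xverts I S, 2 ≤ xpdeg I S w) (hSnc : ∀ f ∈ S, ¬ IsChord I K f) :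
    C₂.card + (xverts I S).card ≤ (xverts I K).card := by
  classical
  have hdeg2 : ∀ c ∈ C₂, ∃ w ∈ xpair I c, degIn I K w = 2 := fun c hc => (hC c hc).2.2.2
  choose φ hφx hφd using hdeg2
  -- three distinct readers of a variable give degree at least three
  have three : ∀ {v : Fin n} {a b c : Fin m}, a ∈ K → b ∈ K → c ∈ K → a ≠ b → a ≠ c → b ≠ c →
      v ∈ varSet I a → v ∈ varSet I b → v ∈ varSet I c → 3 ≤ degIn I K v := by
    intro v a b c ha hb hc hab hac hbc hva hvb hvc
    unfold PstarSAClosure.degIn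
    have hsub : ({a, b, c} : Finset (Fin m)) ⊆ K.filter fun j => v ∈ varSet I j := by
      intro j hj
      rw [mem_filter]
      rcases mem_insert.1 hj with rfl | hj
      · exact ⟨ha, hva⟩
      rcases mem_insert.1 hj with rfl | hj
      · exact ⟨hb, hvb⟩
      · rw [mem_singleton.1 hj]; exact ⟨hc, hvc⟩
    have hcard : ({a, b, c} : Finset (Fin m)).card = 3 := by
      rw [card_insert_of_notMem, card_pair hbc]
      rw [mem_insert, mem_singleton]; push Not; exact ⟨hab, hac⟩
    exact hcard ▸ card_le_card hsub
  -- readers of `φ c`: `c` or a non-clean member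
  have readers : ∀ c (hc : c ∈ C₂), ∀ g ∈ K, φ c hc ∈ xpair I g → g = c ∨ ¬ (IsChord I K g ∧ OutsideGated I K M g) := by
    intro c hc g hg hwg
    by_contra hne
    push Not at hne
    obtain ⟨hgc, hgcl⟩ := hne
    obtain ⟨hcK, hch, hO, -⟩ := hC c hc
    have hwK : φ c hc ∈ xverts I K := (mem_xverts_iff I K _).2 ⟨c, hcK, hφx c hc⟩
    obtain ⟨f, hf, hwf, hnot⟩ := hcov (φ c hc) hwK
    have hfc : f ≠ c := fun h => hnot (h ▸ ⟨hch, hO⟩)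
    have hfg : f ≠ g := fun h => hnot (h ▸ hgcl)
    have h3 := three hcK hg hf (Ne.symm hgc) hfc.symm hfg.symm (mem_varSet_of_mem_xpair (hφx c hc)) (mem_varSet_of_mem_xpair hwg)
      (mem_varSet_of_mem_xpair hwf)
    have := hφd c hc
    omega
  have hinj : ∀ c₁ (h₁ : c₁ ∈ C₂) c₂ (h₂ : c₂ ∈ C₂), φ c₁ h₁ = φ c₂ h₂ → c₁ = c₂ := by
    intro c₁ h₁ c₂ h₂ heq
    rcases readers c₁ h₁ c₂ (hC c₂ h₂).1 (heq ▸ hφx c₂ h₂) with h | h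
    · exact h.symm
    · exact absurd ⟨(hC c₂ h₂).2.1, (hC c₂ h₂).2.2.1⟩ h
  have havoid : ∀ c (hc : c ∈ C₂), φ c hc ∉ xverts I S := by
    intro c hc hwS
    have h2 := hSL _ hwS
    obtain ⟨f, hf, -, hwf⟩ := exists_ne_of_two_le_xpdeg I hI c h2
    obtain ⟨f', hf', hf'f, hwf'⟩ := exists_ne_of_two_le_xpdeg I hI f h2
    obtain ⟨hcK, hch, -, -⟩ := hC c hc
    have hfc : f ≠ c := fun h => hSnc f hf (h ▸ hch)
    have hf'c : f' ≠ c := fun h => hSnc f' hf' (h ▸ hch)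
    have h3 := three hcK (hSK hf) (hSK hf') hfc.symm hf'c.symm hf'f.symm (mem_varSet_of_mem_xpair (hφx c hc))
      (mem_varSet_of_mem_xpair hwf) (mem_varSet_of_mem_xpair hwf')
    have := hφd c hc
    omega
  set T := xverts I K \ xverts I S with hTdef
  have hCT : C₂.card ≤ T.card := by
    refine card_le_card_of_injOn (fun c => if hc : c ∈ C₂ then φ c hc else I.vars c 0) (fun c hc => ?_) ?_
    · have hc' : c ∈ C₂ := mem_coe.1 hc
      simp only [dif_pos hc']
      exact mem_sdiff.2 ⟨(mem_xverts_iff I K _).2 ⟨c, (hC c hc').1, hφx c hc'⟩, havoid c hc'⟩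
    · intro c₁ h₁ c₂ h₂ heq
      have h₁' : c₁ ∈ C₂ := mem_coe.1 h₁
      have h₂' : c₂ ∈ C₂ := mem_coe.1 h₂
      simp only [dif_pos h₁', dif_pos h₂'] at heq
      exact hinj c₁ h₁' c₂ h₂' heq
  have hTcard : T.card + (xverts I S).card = (xverts I K).card := by
    rw [hTdef, card_sdiff_add_card_eq_card (xverts_mono I hSK)]
  omega

/-! ## Adding one inside gate -/

/-- `degIn` of the family with one member inserted. -/
theorem degIn_insert (I : LocalMap 4 n m) {K : Finset (Fin m)} {g : Fin m} (hg : g ∉ K) (v : Fin n) :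
    degIn I (insert g K) v = degIn I K v + (if v ∈ varSet I g then 1 else 0) := by
  classical
  have h := degIn_erase I (mem_insert_self g K) v
  rw [erase_insert hg] at h
  exact h

/-- **Inserting an output whose AND variables are already read and which reads a boundary variable raises `#bdry` by at most one.**
(The new boundary variables are among its two XOR variables; the touched boundary variable is lost.) -/
theorem card_bdry_insert_le (I : LocalMap 4 n m) {K : Finset (Fin m)} {g : Fin m} (hg : g ∉ K)
    (h2 : ∃ j ∈ K, I.vars g 2 ∈ varSet I j) (h3 : ∃ j ∈ K, I.vars g 3 ∈ varSet I j) {v : Fin n} (hv : v ∈ bdry I K) (hvg : v ∈ varSet I g) :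
    (bdry I (insert g K)).card + 1 ≤ (bdry I K).card + 2 := by
  classical
  have hsub : bdry I (insert g K) ⊆ (bdry I K).erase v ∪ {I.vars g 0, I.vars g 1} := by
    intro u hu
    rw [mem_bdry_iff, degIn_insert I hg] at hu
    rw [mem_union]
    by_cases hug : u ∈ varSet I g
    · rw [if_pos hug] at hu
      right
      have hK0 : degIn I K u = 0 := by omega
      have hnot : ∀ j ∈ K, u ∉ varSet I j := by
        intro j hj huj
        have : 0 < degIn I K u := by
          unfold PstarSAClosure.degIn; exact card_pos.2 ⟨j, mem_filter.2 ⟨hj, huj⟩⟩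
        omega
      unfold PstarSALevel.varSet at hug
      obtain ⟨s, -, hs⟩ := mem_image.1 hug
      have h4 : ∀ t : Fin 4, t = 0 ∨ t = 1 ∨ t = 2 ∨ t = 3 := by decide
      rcases h4 s with rfl | rfl | rfl | rfl
      · exact mem_insert.2 (Or.inl hs.symm)
      · exact mem_insert_of_mem (mem_singleton.2 hs.symm)
      · obtain ⟨j, hj, hj'⟩ := h2; exact absurd (hs ▸ hj') (hnot j hj)
      · obtain ⟨j, hj, hj'⟩ := h3; exact absurd (hs ▸ hj') (hnot j hj)
    · rw [if_neg hug, add_zero] at hu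
      left
      rw [mem_erase, mem_bdry_iff]
      exact ⟨fun h => hug (h ▸ hvg), hu⟩
  have h1 := (card_le_card hsub).trans (card_union_le _ _)
  have h2' : ((bdry I K).erase v).card + 1 = (bdry I K).card := card_erase_add_one hv
  have h3' : ({I.vars g 0, I.vars g 1} : Finset (Fin n)).card ≤ 2 := card_insert_le _ _ |>.trans (by rw [card_singleton])
  omega

/-! ## Two clean chords without degree-two endpoints share an endpoint of degree three -/

/-- Two distinct members reading a variable give it degree at least two. -/
theorem two_le_degIn (I : LocalMap 4 n m) {K : Finset (Fin m)} {a b : Fin m} {v : Fin n} (ha : a ∈ K) (hb : b ∈ K) (hab : a ≠ b)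
    (hva : v ∈ varSet I a) (hvb : v ∈ varSet I b) : 2 ≤ degIn I K v := by
  classical
  unfold PstarSAClosure.degIn
  have hsub : ({a, b} : Finset (Fin m)) ⊆ K.filter fun j => v ∈ varSet I j := by
    intro j hj
    rw [mem_filter]
    rcases mem_insert.1 hj with rfl | hj
    · exact ⟨ha, hva⟩
    · rw [mem_singleton.1 hj]; exact ⟨hb, hvb⟩
  exact (card_pair hab) ▸ card_le_card hsub

/-- **Pair deletion.**  On a pure typed `(r,3/2)`-expanding instance, in a family `K` (`#K ≤ r`) with `2·#bdry K ≤ 3·#K + 1`, two distinct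
chords none of whose XOR endpoints is read by exactly two members of `K` share an XOR endpoint read by exactly three members of `K`. -/
theorem exists_shared_deg_three (I : LocalMap 4 n m) (hI : I.IsPure xorAndPred) (hT : Typed I) {r : ℕ} (hB : BoundaryExpanding r I)
    {K : Finset (Fin m)} (hKr : K.card ≤ r) (hslack : 2 * (bdry I K).card ≤ 3 * K.card + 1)
    {c c' : Fin m} (hc : c ∈ K) (hc' : c' ∈ K) (hne : c ≠ c') (hch : IsChord I K c) (hch' : IsChord I K c')
    (hno : ∀ w ∈ xpair I c, degIn I K w ≠ 2) (hno' : ∀ w ∈ xpair I c', degIn I K w ≠ 2) :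
    ∃ w ∈ xpair I c, w ∈ xpair I c' ∧ degIn I K w = 3 := by
  classical
  -- delete `c`
  have h1 := card_bdry_erase_le I hI hc hch
  have hX0 : ((xpair I c).filter fun w => degIn I K w = 2).card = 0 :=
    card_eq_zero.2 (filter_eq_empty_iff.2 fun w hw h => hno w hw h)
  rw [hX0] at h1
  -- `c'` is a chord of `K ∖ c`
  have hc'e : c' ∈ K.erase c := mem_erase.2 ⟨hne.symm, hc'⟩
  have priv : ∀ s : Fin 4, I.vars c' s ∈ bdry I K → I.vars c' s ∈ bdry I (K.erase c) := by
    intro s hs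
    rw [mem_bdry_iff] at hs ⊢
    have hd := degIn_erase I hc (I.vars c' s)
    by_cases hvc : I.vars c' s ∈ varSet I c
    · have h2 := two_le_degIn I hc hc' hne hvc (vars_mem_varSet I c' s)
      omega
    · rw [if_neg hvc] at hd; omega
  have hch'e : IsChord I (K.erase c) c' := ⟨priv 2 hch'.1, priv 3 hch'.2⟩
  -- delete `c'`
  have h2 := card_bdry_erase_le I hI hc'e hch'e
  have hexp := hB ((K.erase c).erase c') (((card_le_card (erase_subset _ _)).trans (card_le_card (erase_subset _ _))).trans hKr)
  have hk1 : (K.erase c).card + 1 = K.card := card_erase_add_one hc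
  have hk2 : ((K.erase c).erase c').card + 1 = (K.erase c).card := card_erase_add_one hc'e
  have hpos : 0 < ((xpair I c').filter fun w => degIn I (K.erase c) w = 2).card := by omega
  obtain ⟨w, hw⟩ := card_pos.1 hpos
  obtain ⟨hwc', hdw⟩ := mem_filter.1 hw
  have hd := degIn_erase I hc w
  rw [hdw] at hd
  by_cases hwc : w ∈ varSet I c
  · rw [if_pos hwc] at hd
    refine ⟨w, ?_, hwc', hd⟩
    rcases (mem_xpair I).1 hwc' with h | h
    · rw [h]; exact mem_xpair_of_mem_varSet hT (s := 0) (by decide) (h ▸ hwc)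
    · rw [h]; exact mem_xpair_of_mem_varSet hT (s := 1) (by decide) (h ▸ hwc)
  · rw [if_neg hwc, add_zero] at hd
    exact absurd hd (hno' w hwc')

end Summit.PneNP.PneNP.Theorems.PstarSlackTools
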